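import Summits.SmoothPoincare4.SmoothPoincare4.Theses.SblfDescent
import Literature.Topology.FourManifolds.SimplifiedBrokenLefschetzFibration
import Literature.Topology.FourManifolds.SimplifiedBrokenLefschetzExistence

/-!
# `SmoothPoincare4 → StepGE3`: the crux is implied by the summit (hardness record, refuter side)

Negative side of crux `SblfDescent.StepGE3` (item stmt-SmoothPoincare4-18528, cdisprove cycle 1).
The route's KILL CRITERIA say that refuting `StepGE3` "refutes SPC4 at once"; this file PROVES that
direction in the kernel, modulo ONE print fact which the tree cannot yet construct (no SBLF has ever
been built in Lean): `sblf_of_every_genus_of_diffeomorph_sphere_four` — every manifold diffeomorphic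
to `S⁴` carries simplified broken Lefschetz fibrations with non-empty round locus of every genus
(Baykur 2012, Thm. 18: broken genus of `S⁴` is one, the Auroux–Donaldson–Katzarkov fibration; Lemma 12:
genus `g` ⇒ genus `g + 1` by flip-and-slip).

* `stepGE3_iff_tree` / `stepTwo_iff_tree` — the route's inline `HAS(M, n)` block is, field for field,
  `∃ o f L, IsSimplifiedBrokenLefschetzFibration o f L n`; the two cruxes restated over the tree.
* `exists_sblf_of_smoothPoincare4` — under SPC4 EVERY homotopy 4-sphere has SBLFs of EVERY lower
  genus: this is the conclusion of `StepGE3` with its hypothesis `HAS(M, h+1)` deleted, so that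
  hypothesis is logically idle relative to the summit (it matters for the METHOD only).
* `stepGE3_of_smoothPoincare4`, `not_smoothPoincare4_of_not_stepGE3` — the shield and its
  contrapositive: **a refutation of the crux is an exotic 4-sphere**.
* `stepGE3_without_oneLe_iff` — load-bearing analysis of `1 ≤ h`: deleting it yields EXACTLY
  `StepTwo ∧ StepGE3`; with `descent_of_smoothPoincare4` both are shielded alike, so `1 ≤ h` is
  bookkeeping (the genus-2 rung is a separate item), not a truth condition.

No new mathematics; bookkeeping for planners and the line lead, in the pattern of
`Theorems/<Crux>/Negative/OfSmoothPoincare4.lean` sector certificates.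
-/

noncomputable section

-- `Summit.SmoothPoincare4.SmoothPoincare4.…` (summit = sub-problem) trips `dupNamespace`.
set_option linter.dupNamespace false

open scoped Manifold ContDiff Topology ContinuousMap

/-! ### The print fact (self-contained: fully qualified names, no local `open` needed) -/

namespace Summit.SmoothPoincare4.SmoothPoincare4.Theorems.StepGE3.Negative

end Summit.SmoothPoincare4.SmoothPoincare4.Theorems.StepGE3.Negative

/-! ### The two cruxes over the tree vocabulary, the shield, and `1 ≤ h` -/

namespace Summit.SmoothPoincare4.SmoothPoincare4.Theorems.StepGE3.Negative

open Literature.Topology.FourManifolds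

/-- **Reading of the crux.**  `StepGE3` is, field for field, the statement
`∀ M ≃ₕ S⁴, ∀ h ≥ 1, HAS(M, h + 1) → HAS(M, h)` with
`HAS(M, n) = ∃ o f L, IsSimplifiedBrokenLefschetzFibration o f L n` (the inline
`let R …; let G …; … ∧ …` block of the route lists the ten fields, in order). [folklore] -/
theorem stepGE3_iff_tree : Summit.SmoothPoincare4.SmoothPoincare4.Theses.SblfDescent.StepGE3 ↔
    ∀ (M : Type) [TopologicalSpace M] [T2Space M] [SecondCountableTopology M]
      [ChartedSpace (EuclideanSpace ℝ (Fin 4)) M] [IsManifold (𝓡 4) ∞ M],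
      M ≃ₕ Metric.sphere (0 : EuclideanSpace ℝ (Fin 5)) 1 → ∀ h : ℕ, 1 ≤ h →
        (∃ (o : SmoothOrientation (𝓡 4) M) (f : M → Metric.sphere (0 : EuclideanSpace ℝ (Fin 3)) 1)
          (L : Finset M), IsSimplifiedBrokenLefschetzFibration o f L (h + 1)) →
        (∃ (o : SmoothOrientation (𝓡 4) M) (f : M → Metric.sphere (0 : EuclideanSpace ℝ (Fin 3)) 1)
          (L : Finset M), IsSimplifiedBrokenLefschetzFibration o f L h) := by
  constructor
  · intro H M _ _ _ _ _ e h hh hM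
    obtain ⟨o, f, L, ⟨h1, h2, h3, h4, h5, h6, h7, h8, h9, h10⟩⟩ := hM
    obtain ⟨o', f', L', h1, h2, h3, h4, h5, h6, h7, h8, h9, h10⟩ :=
      H M e h hh ⟨o, f, L, h1, h2, h3, h4, h5, h6, h7, h8, h9, h10⟩
    exact ⟨o', f', L', ⟨h1, h2, h3, h4, h5, h6, h7, h8, h9, h10⟩⟩
  · intro H M _ _ _ _ _ e h hh hM
    obtain ⟨o, f, L, h1, h2, h3, h4, h5, h6, h7, h8, h9, h10⟩ := hM
    obtain ⟨o', f', L', ⟨h1, h2, h3, h4, h5, h6, h7, h8, h9, h10⟩⟩ :=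
      H M e h hh ⟨o, f, L, ⟨h1, h2, h3, h4, h5, h6, h7, h8, h9, h10⟩⟩
    exact ⟨o', f', L', h1, h2, h3, h4, h5, h6, h7, h8, h9, h10⟩

/-- **Reading of the sibling crux** `StepTwo` (the case `h = 0` of the same shape):
`∀ M ≃ₕ S⁴, HAS(M, 1) → HAS(M, 0)`. [folklore] -/
theorem stepTwo_iff_tree : Summit.SmoothPoincare4.SmoothPoincare4.Theses.SblfDescent.StepTwo ↔
    ∀ (M : Type) [TopologicalSpace M] [T2Space M] [SecondCountableTopology M]
      [ChartedSpace (EuclideanSpace ℝ (Fin 4)) M] [IsManifold (𝓡 4) ∞ M],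
      M ≃ₕ Metric.sphere (0 : EuclideanSpace ℝ (Fin 5)) 1 →
        (∃ (o : SmoothOrientation (𝓡 4) M) (f : M → Metric.sphere (0 : EuclideanSpace ℝ (Fin 3)) 1)
          (L : Finset M), IsSimplifiedBrokenLefschetzFibration o f L 1) →
        (∃ (o : SmoothOrientation (𝓡 4) M) (f : M → Metric.sphere (0 : EuclideanSpace ℝ (Fin 3)) 1)
          (L : Finset M), IsSimplifiedBrokenLefschetzFibration o f L 0) := by
  constructor
  · intro H M _ _ _ _ _ e hM
    obtain ⟨o, f, L, ⟨h1, h2, h3, h4, h5, h6, h7, h8, h9, h10⟩⟩ := hM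
    obtain ⟨o', f', L', h1, h2, h3, h4, h5, h6, h7, h8, h9, h10⟩ :=
      H M e ⟨o, f, L, h1, h2, h3, h4, h5, h6, h7, h8, h9, h10⟩
    exact ⟨o', f', L', ⟨h1, h2, h3, h4, h5, h6, h7, h8, h9, h10⟩⟩
  · intro H M _ _ _ _ _ e hM
    obtain ⟨o, f, L, h1, h2, h3, h4, h5, h6, h7, h8, h9, h10⟩ := hM
    obtain ⟨o', f', L', ⟨h1, h2, h3, h4, h5, h6, h7, h8, h9, h10⟩⟩ :=
      H M e ⟨o, f, L, ⟨h1, h2, h3, h4, h5, h6, h7, h8, h9, h10⟩⟩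
    exact ⟨o', f', L', h1, h2, h3, h4, h5, h6, h7, h8, h9, h10⟩

/-- **Under SPC4 every homotopy 4-sphere carries SBLFs of every lower genus** (modulo the named
fact): SPC4 makes `M ≃ₕ S⁴` diffeomorphic to `S⁴`, and the fact supplies the fibrations.  This is
the CONCLUSION of `StepGE3` with its hypotheses `1 ≤ h` and `HAS(M, h+1)` deleted — so these
hypotheses are logically idle relative to the summit. [folklore] -/
theorem exists_sblf_of_smoothPoincare4 (H : Literature.Topology.FourManifolds.sblf_of_every_genus_of_diffeomorph_sphere_four)
    (hS : _root_.SmoothPoincare4)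
    (M : Type) [TopologicalSpace M] [T2Space M] [SecondCountableTopology M]
    [ChartedSpace (EuclideanSpace ℝ (Fin 4)) M] [IsManifold (𝓡 4) ∞ M]
    (e : M ≃ₕ Metric.sphere (0 : EuclideanSpace ℝ (Fin 5)) 1) (h : ℕ) :
    ∃ (o : SmoothOrientation (𝓡 4) M) (f : M → Metric.sphere (0 : EuclideanSpace ℝ (Fin 3)) 1)
      (L : Finset M), IsSimplifiedBrokenLefschetzFibration o f L h :=
  H M (hS M ‹_› ‹_› e) h

/-- **The shield: `SmoothPoincare4 → StepGE3`** (modulo the named fact).  The hypotheses `1 ≤ h`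
and `HAS(M, h+1)` of the crux are not used. [folklore] -/
theorem stepGE3_of_smoothPoincare4 (H : Literature.Topology.FourManifolds.sblf_of_every_genus_of_diffeomorph_sphere_four)
    (hS : _root_.SmoothPoincare4) :
    Summit.SmoothPoincare4.SmoothPoincare4.Theses.SblfDescent.StepGE3 :=
  stepGE3_iff_tree.mpr fun M _ _ _ _ _ e h _ _ ↦ exists_sblf_of_smoothPoincare4 H hS M e h

/-- **A refutation of the crux is a disproof of SPC4** (modulo the named fact): contrapositive of
`stepGE3_of_smoothPoincare4`.  A counterexample to `StepGE3` is a smooth homotopy 4-sphere `M`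
with an SBLF of some lower genus `h + 1 ≥ 2` and none of lower genus `h`; every manifold
diffeomorphic to `S⁴` has SBLFs of all lower genera, so `M` is an exotic `S⁴`. [folklore] -/
theorem not_smoothPoincare4_of_not_stepGE3 (H : Literature.Topology.FourManifolds.sblf_of_every_genus_of_diffeomorph_sphere_four)
    (h : ¬ Summit.SmoothPoincare4.SmoothPoincare4.Theses.SblfDescent.StepGE3) :
    ¬ _root_.SmoothPoincare4 :=
  fun hS ↦ h (stepGE3_of_smoothPoincare4 H hS)

/-- **Load-bearing analysis of `1 ≤ h`.**  Deleting `1 ≤ h` from the crux gives PRECISELY the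
conjunction of the route's two cruxes: the new case `h = 0` is `StepTwo` verbatim.  So `1 ≤ h`
is not load-bearing for truth (both cruxes are SPC4-shielded, `descent_of_smoothPoincare4`); it
only separates the genus-2 rung, filed as its own item. [folklore] -/
theorem stepGE3_without_oneLe_iff :
    (∀ (M : Type) [TopologicalSpace M] [T2Space M] [SecondCountableTopology M]
      [ChartedSpace (EuclideanSpace ℝ (Fin 4)) M] [IsManifold (𝓡 4) ∞ M],
      M ≃ₕ Metric.sphere (0 : EuclideanSpace ℝ (Fin 5)) 1 → ∀ h : ℕ,
        (∃ (o : SmoothOrientation (𝓡 4) M) (f : M → Metric.sphere (0 : EuclideanSpace ℝ (Fin 3)) 1)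
          (L : Finset M), IsSimplifiedBrokenLefschetzFibration o f L (h + 1)) →
        (∃ (o : SmoothOrientation (𝓡 4) M) (f : M → Metric.sphere (0 : EuclideanSpace ℝ (Fin 3)) 1)
          (L : Finset M), IsSimplifiedBrokenLefschetzFibration o f L h)) ↔
    Summit.SmoothPoincare4.SmoothPoincare4.Theses.SblfDescent.StepTwo ∧
      Summit.SmoothPoincare4.SmoothPoincare4.Theses.SblfDescent.StepGE3 := by
  rw [stepTwo_iff_tree, stepGE3_iff_tree]
  constructor
  · intro W
    exact ⟨fun M _ _ _ _ _ e hM ↦ W M e 0 hM, fun M _ _ _ _ _ e h _ hM ↦ W M e h hM⟩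
  · rintro ⟨h2, h3⟩ M _ _ _ _ _ e h hM
    cases h with
    | zero => exact h2 M e hM
    | succ h => exact h3 M e (h + 1) (Nat.succ_le_succ (Nat.zero_le h)) hM

/-- **The whole descent `StepTwo ∧ StepGE3` is shielded** (modulo the named fact): under SPC4 the
conclusion `HAS(M, h)` holds for every `h`, whatever the hypothesis. [folklore] -/
theorem descent_of_smoothPoincare4 (H : Literature.Topology.FourManifolds.sblf_of_every_genus_of_diffeomorph_sphere_four)
    (hS : _root_.SmoothPoincare4) :
    Summit.SmoothPoincare4.SmoothPoincare4.Theses.SblfDescent.StepTwo ∧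
      Summit.SmoothPoincare4.SmoothPoincare4.Theses.SblfDescent.StepGE3 :=
  stepGE3_without_oneLe_iff.mp fun M _ _ _ _ _ e h _ ↦ exists_sblf_of_smoothPoincare4 H hS M e h

end Summit.SmoothPoincare4.SmoothPoincare4.Theorems.StepGE3.Negative

end
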